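import Literature.Barriers.FinalStateConjecture.KleinGordonRealModePotential
import Literature.Analysis.ODE.JostDecay
import Literature.Analysis.ODE.ComplexSecondOrder
import HarnessLib

/-!
# The radial Klein–Gordon equation on Kerr at complex parameters: complex potential, normal form,
# tail expansion, and the smooth family of exponentially decaying (Jost) solutions at infinity

Topic `Literature/Barriers/FinalStateConjecture` (namespace `Literature.Barriers.FinalStateConjecture`).
Infrastructure for the perturbation of the real threshold mode (`KleinGordonRealMode.lean`) into
the upper half plane (Shlapentokh-Rothman, CMP 329 (2014), §4.3, Lemma 4.5 / Prop. 4.2: "the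
implicit function theorem applied to a matching condition between the horizon-regular solution
and the exponentially decaying solution at infinity, both depending holomorphically/smoothly on
the parameters"). Everything is proved:

* `kgVc M a m ω Λ η r` — the potential (2.2) with a COMPLEX mass-square parameter `η` in place of
  `μ²` (`kgVc_sq`: at `η = μ²` it is `kgRadialPotential`), and the normal-form coefficient
  `kgQc = (kgVc − (M² − a²))/Δ²` (`kgQc_omega0_real`: at `(ω₀, λ, μ²)` real it is `kgQsharp`);
* `isSol2_normalForm` — a solved-form solution pair `(R, R')` of the radial ODE on `(r₊, ∞)` gives
  the solution `y = √Δ R`, `y' = Δ'/(2√Δ) R + √Δ R'` of `y'' = kgQc · y` (`IsSol2`,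
  `ComplexSecondOrder.lean`);
* the **tail expansion** `kgQc − (η − ω²) = (c₃r³ + c₂r² + c₁r + c₀)/Δ²` with explicit polynomial
  coefficients `kgC0 … kgC3` in `(ω, Λ, η)` (`kgQc_sub_eq`), and the bound
  `‖kgQc − (η − ω²)‖ ≤ (100/81)(Σ‖cₖ‖)/r` for `r ≥ max(1, 20(r₊+M))` (`norm_kgQc_sub_le`);
* the **coefficient family** `jw p ∈ BCF` (`p = (ω, Λ, η) ∈ ℂ³`), `jw p (r) = kgQc(max r R₁; p) − γ₀²`
  (`jw_apply`), a POLYNOMIAL map `ℂ³ → BCF` (`contDiff_jw`, holomorphic) with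
  `‖jw p‖ ≤ ‖η − ω² − γ₀²‖ + (100/81)(Σ‖cₖ(p)‖)/R₁` (`norm_jw_le`);
* the **Jost family** `yInf p = jostY γ₀ γ₁ R₁ (jw p)` (`JostDecay.lean`): where
  `C_K ‖jw p‖ < 1` it solves `y'' = kgQc(·; p) y` on `(R₁, ∞)` (`isSol2_yInf`), decays like
  `e^{−γ₁ r}` with its derivative, is not identically zero, and `p ↦ yInf p r`, `p ↦ yInf' p r` are
  holomorphic (`contDiffAt_yInf`, `contDiffAt_yInf'`).

## References

* Y. Shlapentokh-Rothman, Comm. Math. Phys. 329 (2014) 859–891, §2 (2.2), §4.3 (Lemma 4.5),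
  App. A. Key `ShlapentokhRothman2014KleinGordon`.
* P. Hartman, *Ordinary Differential Equations*, SIAM 2002, Ch. X §17. Key `Hartman2002`.
-/

noncomputable section

open Set Filter Topology Complex
open scoped ContDiff

namespace Literature.Barriers.FinalStateConjecture

open Literature.Geometry.Lorentzian Literature.Geometry.Lorentzian.Kerr Literature.Analysis.ODE

variable {M a : ℝ} {m : ℤ}

/-! ### The complex potential and the normal-form coefficient -/

/-- **The radial potential (2.2) with complex mass-square `η`**:
`V = −(r²+a²)²ω² + 4Mamrω − a²m² + Δ(Λ + a²ω² + η r²)`. [cite: ShlapentokhRothman2014KleinGordon, §2 (2.2)] -/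
def kgVc (M a : ℝ) (m : ℤ) (w Λ η : ℂ) (r : ℝ) : ℂ :=
  -((((r ^ 2 + a ^ 2) ^ 2 : ℝ)) : ℂ) * w ^ 2 + (((4 * M * a * m * r : ℝ)) : ℂ) * w - (((a ^ 2 * (m : ℝ) ^ 2 : ℝ)) : ℂ) +
    (delta M a r : ℂ) * (Λ + ((a ^ 2 : ℝ) : ℂ) * w ^ 2 + η * (((r ^ 2 : ℝ)) : ℂ))

/-- At `η = μ²` the complexified potential is the potential (2.2). [folklore] -/
theorem kgVc_sq (w Λ : ℂ) (μ r : ℝ) : kgVc M a m w Λ (((μ ^ 2 : ℝ)) : ℂ) r = kgRadialPotential M a w m Λ μ r := by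
  unfold kgVc kgRadialPotential
  push_cast
  ring

/-- **The normal-form coefficient** `q♯ = (V − (M² − a²))/Δ²` (complex parameters). [folklore] -/
def kgQc (M a : ℝ) (m : ℤ) (w Λ η : ℂ) (r : ℝ) : ℂ :=
  (kgVc M a m w Λ η r - (((M ^ 2 - a ^ 2 : ℝ)) : ℂ)) / (delta M a r : ℂ) ^ 2

/-- At the real threshold parameters `(ω₀, λ, μ²)` the complex coefficient is the real `q♯` of
`KleinGordonRealModePotential.lean`. [folklore] -/
theorem kgQc_omega0_real (h : IsSubextremal M a) (lam μ r : ℝ) :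
    kgQc M a m (kgOmega0 M a m : ℂ) (lam : ℂ) (((μ ^ 2 : ℝ)) : ℂ) r = ((kgQsharp M a m lam μ r : ℝ) : ℂ) := by
  unfold kgQc kgQsharp
  rw [kgVc_sq, kgRadialPotential_omega0 h]
  push_cast
  ring

/-- `kgQc` is continuous on `(r₊, ∞)`. [folklore] -/
theorem continuousOn_kgQc (h : IsSubextremal M a) (w Λ η : ℂ) : ContinuousOn (kgQc M a m w Λ η) (Ioi (rPlus M a)) := by
  have hc : Continuous fun r : ℝ ↦ kgVc M a m w Λ η r - (((M ^ 2 - a ^ 2 : ℝ)) : ℂ) := by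
    unfold kgVc delta; fun_prop
  have hd : Continuous fun r : ℝ ↦ (delta M a r : ℂ) ^ 2 := by unfold delta; fun_prop
  refine hc.continuousOn.div hd.continuousOn fun r hr ↦ pow_ne_zero 2 ?_
  exact_mod_cast (delta_pos h.le hr).ne'

/-! ### The normal form `y = √Δ R` (complex-valued solutions) -/

/-- **Normal form.** If `(R, R')` is a solution pair of the radial ODE in solved form on `(r₊, ∞)`
(`R'' = −(Δ'/Δ)R' + (V/Δ²)R`, `V` the potential (2.2) at `(ω, Λ, μ)`), then `y = √Δ R`,
`y' = (2r−2M)/(2√Δ) R + √Δ R'` solve `y'' = kgQc(·; ω, Λ, μ²) y` on `(r₊, ∞)`.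
[cite: ShlapentokhRothman2014KleinGordon, §4.2] -/
theorem isSol2_normalForm (h : IsSubextremal M a) {w Λ : ℂ} {μ : ℝ} {R R' : ℝ → ℂ}
    (hsol : ∀ t ∈ Ioi (rPlus M a), HasDerivAt R (R' t) t ∧
      HasDerivAt R' (-((((2 * t - 2 * M : ℝ)) : ℂ) / (delta M a t : ℂ)) * R' t +
        kgRadialPotential M a w m Λ μ t / (delta M a t : ℂ) ^ 2 * R t) t) :
    IsSol2 (kgQc M a m w Λ (((μ ^ 2 : ℝ)) : ℂ)) (fun t ↦ ((Real.sqrt (delta M a t) : ℝ) : ℂ) * R t)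
      (fun t ↦ (((2 * t - 2 * M) / (2 * Real.sqrt (delta M a t)) : ℝ) : ℂ) * R t + ((Real.sqrt (delta M a t) : ℝ) : ℂ) * R' t)
      (Ioi (rPlus M a)) := by
  have hD : ∀ t ∈ Ioi (rPlus M a), 0 < delta M a t := fun t ht ↦ delta_pos h.le ht
  -- derivative of `√Δ` and of `Δ'/(2√Δ)`
  have hΔd : ∀ t : ℝ, HasDerivAt (delta M a) (2 * t - 2 * M) t := fun t ↦ by
    have hid := hasDerivAt_id' t
    have h3 := ((hid.mul hid).sub (hid.const_mul (2 * M))).add_const (a ^ 2)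
    have hfd : delta M a = fun x ↦ x * x - 2 * M * x + a ^ 2 := by funext x; unfold delta; ring
    rw [hfd]
    exact h3.congr_deriv (by ring)
  have hS : ∀ t ∈ Ioi (rPlus M a), HasDerivAt (fun s ↦ Real.sqrt (delta M a s)) ((2 * t - 2 * M) / (2 * Real.sqrt (delta M a t))) t :=
    fun t ht ↦ (hΔd t).sqrt (hD t ht).ne'
  have hS' : ∀ t ∈ Ioi (rPlus M a), HasDerivAt (fun s ↦ (2 * s - 2 * M) / (2 * Real.sqrt (delta M a s)))
      ((2 * (2 * Real.sqrt (delta M a t)) - (2 * t - 2 * M) * (2 * ((2 * t - 2 * M) / (2 * Real.sqrt (delta M a t))))) /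
        (2 * Real.sqrt (delta M a t)) ^ 2) t := by
    intro t ht
    have hnum : HasDerivAt (fun s : ℝ ↦ 2 * s - 2 * M) 2 t := by
      simpa using ((hasDerivAt_id t).const_mul 2).sub_const (2 * M)
    have hden : HasDerivAt (fun s ↦ 2 * Real.sqrt (delta M a s)) (2 * ((2 * t - 2 * M) / (2 * Real.sqrt (delta M a t)))) t :=
      (hS t ht).const_mul 2
    have hne : 2 * Real.sqrt (delta M a t) ≠ 0 := mul_ne_zero two_ne_zero (Real.sqrt_pos.2 (hD t ht)).ne'
    exact hnum.div hden hne
  refine ⟨fun t ht ↦ ?_, fun t ht ↦ ?_⟩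
  · have h1 := ((hS t ht).ofReal_comp).mul (hsol t ht).1
    refine h1.congr_deriv ?_
    push_cast
    ring
  · obtain ⟨hu, hu'⟩ := hsol t ht
    have hSt := (hS t ht).ofReal_comp
    have hS't := (hS' t ht).ofReal_comp
    have h2 := (hS't.mul hu).add (hSt.mul hu')
    refine h2.congr_deriv ?_
    have hDt := hD t ht
    have hsq : Real.sqrt (delta M a t) ^ 2 = delta M a t := Real.sq_sqrt hDt.le
    have hS0 : Real.sqrt (delta M a t) ≠ 0 := (Real.sqrt_pos.2 hDt).ne'
    set S := Real.sqrt (delta M a t) with hSdef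
    have hD' : delta M a t = t ^ 2 - 2 * M * t + a ^ 2 := rfl
    have hSc : (S : ℂ) ≠ 0 := by exact_mod_cast hS0
    have hsqc : (S : ℂ) ^ 2 = (t : ℂ) ^ 2 - 2 * M * t + a ^ 2 := by
      have := congrArg (fun x : ℝ ↦ (x : ℂ)) hsq
      simpa [hD'] using this
    have hΔS : (delta M a t : ℂ) = (S : ℂ) ^ 2 := by rw [hsqc, hD']; push_cast; ring
    unfold kgQc
    rw [kgVc_sq]
    set V := kgRadialPotential M a w m Λ μ t with hV
    set u := R t
    set u1 := R' t
    push_cast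
    simp only [hΔS]
    field_simp
    linear_combination u * hsqc

/-! ### The tail expansion of `kgQc` -/

/-- Tail coefficient `c₃ = −4Mω² + 2Mη`. [folklore] -/
def kgC3 (M : ℝ) (w η : ℂ) : ℂ := -4 * M * w ^ 2 + 2 * M * η

/-- Tail coefficient `c₂ = 4M²ω² − (a²+4M²)η + Λ + a²ω²`. [folklore] -/
def kgC2 (M a : ℝ) (w Λ η : ℂ) : ℂ := 4 * M ^ 2 * w ^ 2 - (a ^ 2 + 4 * M ^ 2) * η + Λ + a ^ 2 * w ^ 2

/-- Tail coefficient `c₁ = −4Ma²ω² + 4Ma²η − 2M(Λ + a²ω²) + 4Mamω`. [folklore] -/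
def kgC1 (M a : ℝ) (m : ℤ) (w Λ η : ℂ) : ℂ :=
  -4 * M * a ^ 2 * w ^ 2 + 4 * M * a ^ 2 * η - 2 * M * (Λ + a ^ 2 * w ^ 2) + 4 * M * a * m * w

/-- Tail coefficient `c₀ = −a⁴η + a²(Λ + a²ω²) − a²m² − M² + a²`. [folklore] -/
def kgC0 (M a : ℝ) (m : ℤ) (w Λ η : ℂ) : ℂ := -a ^ 4 * η + a ^ 2 * (Λ + a ^ 2 * w ^ 2) - a ^ 2 * m ^ 2 - M ^ 2 + a ^ 2

/-- The sum of the norms of the tail coefficients. [folklore] -/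
def kgCsum (M a : ℝ) (m : ℤ) (w Λ η : ℂ) : ℝ :=
  ‖kgC3 M w η‖ + ‖kgC2 M a w Λ η‖ + ‖kgC1 M a m w Λ η‖ + ‖kgC0 M a m w Λ η‖

/-- The polynomial identity behind the tail expansion:
`V − (M²−a²) − Δ²(η − ω²) = c₃r³ + c₂r² + c₁r + c₀`. [folklore] -/
theorem kgVc_expand (w Λ η : ℂ) (r : ℝ) :
    kgVc M a m w Λ η r - (((M ^ 2 - a ^ 2 : ℝ)) : ℂ) - (delta M a r : ℂ) ^ 2 * (η - w ^ 2) =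
      kgC3 M w η * r ^ 3 + kgC2 M a w Λ η * r ^ 2 + kgC1 M a m w Λ η * r + kgC0 M a m w Λ η := by
  unfold kgVc kgC3 kgC2 kgC1 kgC0 delta
  push_cast
  ring

/-- **Tail expansion**: `kgQc − (η − ω²) = (c₃r³ + c₂r² + c₁r + c₀)/Δ²` on `(r₊, ∞)`. [folklore] -/
theorem kgQc_sub_eq (h : IsSubextremal M a) (w Λ η : ℂ) {r : ℝ} (hr : rPlus M a < r) :
    kgQc M a m w Λ η r - (η - w ^ 2) =
      (kgC3 M w η * r ^ 3 + kgC2 M a w Λ η * r ^ 2 + kgC1 M a m w Λ η * r + kgC0 M a m w Λ η) / (delta M a r : ℂ) ^ 2 := by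
  have hΔ : (delta M a r : ℂ) ≠ 0 := by exact_mod_cast (delta_pos h.le hr).ne'
  rw [← kgVc_expand, kgQc]
  field_simp

/-- **Tail bound**: `‖kgQc − (η − ω²)‖ ≤ (100/81)(Σ‖cₖ‖)/r` for `r ≥ 20(r₊+M)`, `r ≥ 1`. [folklore] -/
theorem norm_kgQc_sub_le (h : IsSubextremal M a) (w Λ η : ℂ) {r : ℝ} (hr : 20 * (rPlus M a + M) ≤ r) (hr1 : 1 ≤ r) :
    ‖kgQc M a m w Λ η r - (η - w ^ 2)‖ ≤ 100 / 81 * kgCsum M a m w Λ η / r := by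
  obtain ⟨hΔ, -, hrp, hr0⟩ := delta_ge_of_far h hr
  rw [kgQc_sub_eq h w Λ η hrp, norm_div, norm_pow, Complex.norm_real, Real.norm_eq_abs,
    abs_of_pos (delta_pos h.le hrp)]
  have hD2 : 81 / 100 * r ^ 4 ≤ delta M a r ^ 2 := by nlinarith [hΔ, sq_nonneg r]
  have hD0 : 0 < delta M a r ^ 2 := pow_pos (delta_pos h.le hrp) 2
  -- numerator bound
  have hN : ‖kgC3 M w η * r ^ 3 + kgC2 M a w Λ η * r ^ 2 + kgC1 M a m w Λ η * r + kgC0 M a m w Λ η‖ ≤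
      kgCsum M a m w Λ η * r ^ 3 := by
    have e3 : ‖kgC3 M w η * r ^ 3‖ = ‖kgC3 M w η‖ * r ^ 3 := by
      rw [norm_mul]; congr 1; rw [show (r : ℂ) ^ 3 = ((r ^ 3 : ℝ) : ℂ) by push_cast; ring, Complex.norm_real,
        Real.norm_eq_abs, abs_of_pos (by positivity)]
    have e2 : ‖kgC2 M a w Λ η * r ^ 2‖ ≤ ‖kgC2 M a w Λ η‖ * r ^ 3 := by
      rw [norm_mul, show (r : ℂ) ^ 2 = ((r ^ 2 : ℝ) : ℂ) by push_cast; ring, Complex.norm_real, Real.norm_eq_abs,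
        abs_of_pos (by positivity)]
      exact mul_le_mul_of_nonneg_left (by nlinarith) (norm_nonneg _)
    have e1 : ‖kgC1 M a m w Λ η * r‖ ≤ ‖kgC1 M a m w Λ η‖ * r ^ 3 := by
      rw [norm_mul, Complex.norm_real, Real.norm_eq_abs, abs_of_pos hr0]
      exact mul_le_mul_of_nonneg_left (by nlinarith) (norm_nonneg _)
    have e0 : ‖kgC0 M a m w Λ η‖ ≤ ‖kgC0 M a m w Λ η‖ * r ^ 3 := by
      have : (1 : ℝ) ≤ r ^ 3 := one_le_pow₀ hr1
      nlinarith [norm_nonneg (kgC0 M a m w Λ η)]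
    have n1 := norm_add_le (kgC3 M w η * r ^ 3 + kgC2 M a w Λ η * r ^ 2 + kgC1 M a m w Λ η * r) (kgC0 M a m w Λ η)
    have n2 := norm_add_le (kgC3 M w η * r ^ 3 + kgC2 M a w Λ η * r ^ 2) (kgC1 M a m w Λ η * r)
    have n3 := norm_add_le (kgC3 M w η * (r : ℂ) ^ 3) (kgC2 M a w Λ η * r ^ 2)
    have hs : kgCsum M a m w Λ η * r ^ 3 = ‖kgC3 M w η‖ * r ^ 3 + ‖kgC2 M a w Λ η‖ * r ^ 3 + ‖kgC1 M a m w Λ η‖ * r ^ 3 +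
        ‖kgC0 M a m w Λ η‖ * r ^ 3 := by unfold kgCsum; ring
    linarith [e3.le, e3.ge]
  rw [div_le_iff₀ hD0]
  calc ‖kgC3 M w η * r ^ 3 + kgC2 M a w Λ η * r ^ 2 + kgC1 M a m w Λ η * r + kgC0 M a m w Λ η‖
      ≤ kgCsum M a m w Λ η * r ^ 3 := hN
    _ = 100 / 81 * kgCsum M a m w Λ η / r * (81 / 100 * r ^ 4) := by field_simp
    _ ≤ 100 / 81 * kgCsum M a m w Λ η / r * delta M a r ^ 2 := by
        refine mul_le_mul_of_nonneg_left hD2 ?_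
        have : 0 ≤ kgCsum M a m w Λ η := by unfold kgCsum; positivity
        positivity

/-- The tail coefficients are continuous in the parameters `p = (ω, Λ, η)`. [folklore] -/
theorem continuous_kgCsum : Continuous fun p : ℂ × ℂ × ℂ ↦ kgCsum M a m p.1 p.2.1 p.2.2 := by
  unfold kgCsum kgC3 kgC2 kgC1 kgC0
  fun_prop

/-! ### The coefficient family `jw : ℂ³ → BCF` -/

/-- The tail basis function `r ↦ (max r R₁)^k / Δ(max r R₁)²`. [folklore] -/
def tailFn (M a R₁ : ℝ) (k : ℕ) (r : ℝ) : ℂ := ((((max r R₁) ^ k : ℝ)) : ℂ) / (delta M a (max r R₁) : ℂ) ^ 2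

/-- Continuity of the tail basis functions (`R₁ > r₊`). [folklore] -/
theorem continuous_tailFn (h : IsSubextremal M a) {R₁ : ℝ} (hR : rPlus M a < R₁) (k : ℕ) : Continuous (tailFn M a R₁ k) := by
  have hc : Continuous fun r : ℝ ↦ max r R₁ := continuous_id.max continuous_const
  have h1 : Continuous fun r : ℝ ↦ ((((max r R₁) ^ k : ℝ)) : ℂ) := by fun_prop
  have h2 : Continuous fun r : ℝ ↦ (delta M a (max r R₁) : ℂ) ^ 2 := by unfold delta; fun_prop
  refine h1.div h2 fun r ↦ pow_ne_zero 2 ?_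
  have : rPlus M a < max r R₁ := lt_of_lt_of_le hR (le_max_right _ _)
  exact_mod_cast (delta_pos h.le this).ne'

/-- Bound of the tail basis functions: `‖tailFn k r‖ ≤ (100/81)/R₁` for `k ≤ 3`,
`R₁ ≥ max(1, 20(r₊+M))`. [folklore] -/
theorem norm_tailFn_le (h : IsSubextremal M a) {R₁ : ℝ} (hR : 20 * (rPlus M a + M) ≤ R₁) (hR1 : 1 ≤ R₁) {k : ℕ} (hk : k ≤ 3)
    (r : ℝ) : ‖tailFn M a R₁ k r‖ ≤ 100 / 81 / R₁ := by
  set s := max r R₁ with hs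
  have hsR : R₁ ≤ s := le_max_right _ _
  have hs1 : 1 ≤ s := hR1.trans hsR
  have hs20 : 20 * (rPlus M a + M) ≤ s := hR.trans hsR
  obtain ⟨hΔ, -, hrp, hs0⟩ := delta_ge_of_far h hs20
  have hD0 : 0 < delta M a s := delta_pos h.le hrp
  rw [tailFn, ← hs, norm_div, norm_pow, Complex.norm_real, Complex.norm_real, Real.norm_eq_abs, Real.norm_eq_abs,
    abs_of_pos hD0, abs_of_nonneg (by positivity), div_le_div_iff₀ (by positivity) (by positivity)]
  have hk' : s ^ k ≤ s ^ 3 := pow_le_pow_right₀ hs1 hk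
  have hD2 : 81 / 100 * s ^ 4 ≤ delta M a s ^ 2 := by nlinarith [hΔ, sq_nonneg s]
  have hR0 : 0 < R₁ := by linarith
  calc s ^ k * R₁ ≤ s ^ 3 * s := mul_le_mul hk' hsR hR0.le (by positivity)
    _ = 100 / 81 * (81 / 100 * s ^ 4) := by ring
    _ ≤ 100 / 81 * delta M a s ^ 2 := by nlinarith

/-- The tail basis functions as elements of `BCF`. [folklore] -/
def tailBCF (h : IsSubextremal M a) {R₁ : ℝ} (hR : 20 * (rPlus M a + M) ≤ R₁) (hR1 : 1 ≤ R₁) {k : ℕ} (hk : k ≤ 3) : BCF :=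
  BCF.mk (tailFn M a R₁ k) (continuous_tailFn h (delta_ge_of_far h hR).2.2.1 k) (100 / 81 / R₁) (norm_tailFn_le h hR hR1 hk)

/-- Norm of the tail basis elements. [folklore] -/
theorem norm_tailBCF_le (h : IsSubextremal M a) {R₁ : ℝ} (hR : 20 * (rPlus M a + M) ≤ R₁) (hR1 : 1 ≤ R₁) {k : ℕ} (hk : k ≤ 3) :
    ‖tailBCF h hR hR1 hk‖ ≤ 100 / 81 / R₁ :=
  BCF.norm_mk_le (by have : (0 : ℝ) < R₁ := by linarith
                     positivity) _

/-- Values of the tail basis elements. [folklore] -/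
@[simp] theorem tailBCF_apply (h : IsSubextremal M a) {R₁ : ℝ} (hR : 20 * (rPlus M a + M) ≤ R₁) (hR1 : 1 ≤ R₁) {k : ℕ}
    (hk : k ≤ 3) (r : ℝ) : tailBCF h hR hR1 hk r = tailFn M a R₁ k r := rfl

section Family

variable (h : IsSubextremal M a) (m) (γ₀ : ℂ) {R₁ : ℝ} (hR : 20 * (rPlus M a + M) ≤ R₁) (hR1 : 1 ≤ R₁)

/-- **The coefficient family** `jw(p) = (η − ω² − γ₀²)·1 + Σₖ cₖ(p)·tailBCF k ∈ BCF`,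
`p = (ω, Λ, η)`: the frozen normal-form coefficient minus `γ₀²` (`jw_apply`). [folklore] -/
def jw (p : ℂ × ℂ × ℂ) : BCF :=
  (p.2.2 - p.1 ^ 2 - γ₀ ^ 2) • BoundedContinuousFunction.const ℝ (1 : ℂ) +
    kgC3 M p.1 p.2.2 • tailBCF h hR hR1 (k := 3) le_rfl + kgC2 M a p.1 p.2.1 p.2.2 • tailBCF h hR hR1 (k := 2) (by norm_num) +
    kgC1 M a m p.1 p.2.1 p.2.2 • tailBCF h hR hR1 (k := 1) (by norm_num) +
    kgC0 M a m p.1 p.2.1 p.2.2 • tailBCF h hR hR1 (k := 0) (by norm_num)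

/-- **`jw p (r) = kgQc(max r R₁; p) − γ₀²`.** [folklore] -/
theorem jw_apply (p : ℂ × ℂ × ℂ) (r : ℝ) : jw m h γ₀ hR hR1 p r = kgQc M a m p.1 p.2.1 p.2.2 (max r R₁) - γ₀ ^ 2 := by
  have hrp : rPlus M a < max r R₁ := lt_of_lt_of_le (delta_ge_of_far h hR).2.2.1 (le_max_right _ _)
  have hsub := kgQc_sub_eq (m := m) h p.1 p.2.1 p.2.2 hrp
  have hq : kgQc M a m p.1 p.2.1 p.2.2 (max r R₁) =
      (kgC3 M p.1 p.2.2 * (max r R₁) ^ 3 + kgC2 M a p.1 p.2.1 p.2.2 * (max r R₁) ^ 2 + kgC1 M a m p.1 p.2.1 p.2.2 * (max r R₁) +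
        kgC0 M a m p.1 p.2.1 p.2.2) / (delta M a (max r R₁) : ℂ) ^ 2 + (p.2.2 - p.1 ^ 2) := by
    rw [← hsub]; ring
  simp only [jw, BoundedContinuousFunction.coe_add, BoundedContinuousFunction.coe_smul, Pi.add_apply,
    BoundedContinuousFunction.const_apply', tailBCF_apply, tailFn, smul_eq_mul]
  rw [hq]
  push_cast
  ring

/-- The tail coefficients are holomorphic (polynomial) in `p = (ω, Λ, η)`. [folklore] -/
theorem contDiff_kgC {n : WithTop ℕ∞} :
    ContDiff ℂ n (fun p : ℂ × ℂ × ℂ ↦ kgC3 M p.1 p.2.2) ∧ ContDiff ℂ n (fun p : ℂ × ℂ × ℂ ↦ kgC2 M a p.1 p.2.1 p.2.2) ∧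
      ContDiff ℂ n (fun p : ℂ × ℂ × ℂ ↦ kgC1 M a m p.1 p.2.1 p.2.2) ∧ ContDiff ℂ n (fun p : ℂ × ℂ × ℂ ↦ kgC0 M a m p.1 p.2.1 p.2.2) := by
  have c1 : ContDiff ℂ n fun p : ℂ × ℂ × ℂ ↦ p.1 := contDiff_fst
  have c2 : ContDiff ℂ n fun p : ℂ × ℂ × ℂ ↦ p.2.1 := contDiff_fst.comp contDiff_snd
  have c3 : ContDiff ℂ n fun p : ℂ × ℂ × ℂ ↦ p.2.2 := contDiff_snd.comp contDiff_snd
  unfold kgC3 kgC2 kgC1 kgC0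
  refine ⟨?_, ?_, ?_, ?_⟩
  · exact (contDiff_const.mul (c1.pow 2)).add (contDiff_const.mul c3)
  · exact (((contDiff_const.mul (c1.pow 2)).sub (contDiff_const.mul c3)).add c2).add (contDiff_const.mul (c1.pow 2))
  · exact (((contDiff_const.mul (c1.pow 2)).add (contDiff_const.mul c3)).sub
      (contDiff_const.mul (c2.add (contDiff_const.mul (c1.pow 2))))).add (contDiff_const.mul c1)
  · exact ((((contDiff_const.mul c3).add (contDiff_const.mul (c2.add (contDiff_const.mul (c1.pow 2))))).sub
      contDiff_const).sub contDiff_const).add contDiff_const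

set_option maxHeartbeats 400000 in
/-- **`jw` is holomorphic (polynomial) in `p`.** [folklore] -/
theorem contDiff_jw {n : WithTop ℕ∞} : ContDiff ℂ n (jw m h γ₀ hR hR1) := by
  obtain ⟨k3, k2, k1, k0⟩ := contDiff_kgC (M := M) (a := a) (m := m) (n := n)
  have c1 : ContDiff ℂ n fun p : ℂ × ℂ × ℂ ↦ p.1 := contDiff_fst
  have c3 : ContDiff ℂ n fun p : ℂ × ℂ × ℂ ↦ p.2.2 := contDiff_snd.comp contDiff_snd
  have t0 : ContDiff ℂ n fun p : ℂ × ℂ × ℂ ↦ (p.2.2 - p.1 ^ 2 - γ₀ ^ 2) • BoundedContinuousFunction.const ℝ (1 : ℂ) :=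
    ((c3.sub (c1.pow 2)).sub contDiff_const).smul contDiff_const
  have t3 : ContDiff ℂ n fun p : ℂ × ℂ × ℂ ↦ kgC3 M p.1 p.2.2 • tailBCF h hR hR1 (k := 3) le_rfl := k3.smul contDiff_const
  have t2 : ContDiff ℂ n fun p : ℂ × ℂ × ℂ ↦ kgC2 M a p.1 p.2.1 p.2.2 • tailBCF h hR hR1 (k := 2) (by norm_num) :=
    k2.smul contDiff_const
  have t1 : ContDiff ℂ n fun p : ℂ × ℂ × ℂ ↦ kgC1 M a m p.1 p.2.1 p.2.2 • tailBCF h hR hR1 (k := 1) (by norm_num) :=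
    k1.smul contDiff_const
  have t00 : ContDiff ℂ n fun p : ℂ × ℂ × ℂ ↦ kgC0 M a m p.1 p.2.1 p.2.2 • tailBCF h hR hR1 (k := 0) (by norm_num) :=
    k0.smul contDiff_const
  exact (((t0.add t3).add t2).add t1).add t00

/-- **Norm bound**: `‖jw p‖ ≤ ‖η − ω² − γ₀²‖ + (100/81)(Σ‖cₖ(p)‖)/R₁`. [folklore] -/
theorem norm_jw_le (p : ℂ × ℂ × ℂ) :
    ‖jw m h γ₀ hR hR1 p‖ ≤ ‖p.2.2 - p.1 ^ 2 - γ₀ ^ 2‖ + 100 / 81 * kgCsum M a m p.1 p.2.1 p.2.2 / R₁ := by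
  have hR0 : (0 : ℝ) < R₁ := by linarith
  have hone : ‖BoundedContinuousFunction.const ℝ (1 : ℂ)‖ ≤ 1 := by
    refine (BoundedContinuousFunction.norm_le zero_le_one).2 fun r ↦ ?_
    simp
  have t3 := norm_tailBCF_le h hR hR1 (k := 3) le_rfl
  have t2 := norm_tailBCF_le h hR hR1 (k := 2) (by norm_num)
  have t1 := norm_tailBCF_le h hR hR1 (k := 1) (by norm_num)
  have t0 := norm_tailBCF_le h hR hR1 (k := 0) (by norm_num)
  unfold jw
  refine (norm_add_le _ _).trans ?_
  refine (add_le_add (norm_add_le _ _) le_rfl).trans ?_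
  refine (add_le_add (add_le_add (norm_add_le _ _) le_rfl) le_rfl).trans ?_
  refine (add_le_add (add_le_add (add_le_add (norm_add_le _ _) le_rfl) le_rfl) le_rfl).trans ?_
  simp only [norm_smul]
  have e0 : ‖p.2.2 - p.1 ^ 2 - γ₀ ^ 2‖ * ‖BoundedContinuousFunction.const ℝ (1 : ℂ)‖ ≤ ‖p.2.2 - p.1 ^ 2 - γ₀ ^ 2‖ := by
    nlinarith [norm_nonneg (p.2.2 - p.1 ^ 2 - γ₀ ^ 2), norm_nonneg (BoundedContinuousFunction.const ℝ (1 : ℂ))]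
  have e3 := mul_le_mul_of_nonneg_left t3 (norm_nonneg (kgC3 M p.1 p.2.2))
  have e2 := mul_le_mul_of_nonneg_left t2 (norm_nonneg (kgC2 M a p.1 p.2.1 p.2.2))
  have e1 := mul_le_mul_of_nonneg_left t1 (norm_nonneg (kgC1 M a m p.1 p.2.1 p.2.2))
  have e00 := mul_le_mul_of_nonneg_left t0 (norm_nonneg (kgC0 M a m p.1 p.2.1 p.2.2))
  have hsum : ‖kgC3 M p.1 p.2.2‖ * (100 / 81 / R₁) + ‖kgC2 M a p.1 p.2.1 p.2.2‖ * (100 / 81 / R₁) +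
      ‖kgC1 M a m p.1 p.2.1 p.2.2‖ * (100 / 81 / R₁) + ‖kgC0 M a m p.1 p.2.1 p.2.2‖ * (100 / 81 / R₁) =
        100 / 81 * kgCsum M a m p.1 p.2.1 p.2.2 / R₁ := by
    unfold kgCsum; field_simp
  linarith

/-! ### The Jost family -/

variable {γ₀} {γ₁ : ℝ} (h₁ : 0 ≤ γ₁) (hγ : γ₁ < γ₀.re)

/-- **The exponentially decaying solution at infinity** for the parameter `p = (ω, Λ, η)`. [cite: Hartman2002, Ch. X §17] -/
def yInf (p : ℂ × ℂ × ℂ) (r : ℝ) : ℂ := jostY h₁ hγ R₁ (jw m h γ₀ hR hR1 p) r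

/-- Its derivative. [folklore] -/
def yInf' (p : ℂ × ℂ × ℂ) (r : ℝ) : ℂ := jostYder h₁ hγ R₁ (w := jw m h γ₀ hR hR1 p) r

/-- **The Jost family solves `y'' = kgQc(·; p) y` on `(R₁, ∞)`.** [cite: Hartman2002, Ch. X §17] -/
theorem isSol2_yInf {p : ℂ × ℂ × ℂ} (hw : jostKconst γ₀ γ₁ * ‖jw m h γ₀ hR hR1 p‖ < 1) :
    IsSol2 (kgQc M a m p.1 p.2.1 p.2.2) (yInf m h hR hR1 h₁ hγ p) (yInf' m h hR hR1 h₁ hγ p) (Ioi R₁) := by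
  refine ⟨fun t ht ↦ hasDerivAt_jostY h₁ hγ R₁ hw ht, fun t ht ↦ ?_⟩
  have hd := hasDerivAt_jostYder h₁ hγ R₁ hw ht
  refine hd.congr_deriv ?_
  unfold yInf
  rw [jw_apply, max_eq_left (le_of_lt ht)]
  ring

/-- **Decay of the Jost family**: `‖y‖ ≤ e^{−γ₁(r−R₁)}/(1 − C_K‖jw p‖)`. [cite: Hartman2002, Ch. X §17] -/
theorem norm_yInf_le {p : ℂ × ℂ × ℂ} (hw : jostKconst γ₀ γ₁ * ‖jw m h γ₀ hR hR1 p‖ < 1) (r : ℝ) :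
    ‖yInf m h hR hR1 h₁ hγ p r‖ ≤ Real.exp (-(γ₁ * (r - R₁))) * (1 / (1 - jostKconst γ₀ γ₁ * ‖jw m h γ₀ hR hR1 p‖)) :=
  norm_jostY_le h₁ hγ R₁ hw r

/-- **Decay of the derivative of the Jost family.** [cite: Hartman2002, Ch. X §17] -/
theorem norm_yInf'_le {p : ℂ × ℂ × ℂ} (hw : jostKconst γ₀ γ₁ * ‖jw m h γ₀ hR hR1 p‖ < 1) {r : ℝ} (hr : R₁ ≤ r) :
    ‖yInf' m h hR hR1 h₁ hγ p r‖ ≤ Real.exp (-(γ₁ * (r - R₁))) *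
      (‖γ₀‖ + 1 / 2 * (1 / (γ₀.re - γ₁) + 1 / (γ₀.re + γ₁)) *
        (‖jw m h γ₀ hR hR1 p‖ * (1 / (1 - jostKconst γ₀ γ₁ * ‖jw m h γ₀ hR hR1 p‖)))) :=
  norm_jostYder_le h₁ hγ R₁ hw hr

/-- **The Jost family is not identically zero.** [folklore] -/
theorem exists_yInf_ne_zero {p : ℂ × ℂ × ℂ} (hw : jostKconst γ₀ γ₁ * ‖jw m h γ₀ hR hR1 p‖ < 1) :
    ∃ r, R₁ < r ∧ yInf m h hR hR1 h₁ hγ p r ≠ 0 :=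
  exists_jostY_ne_zero h₁ hγ R₁ hw

/-- **Holomorphy of the Jost family in the parameters** at fixed `r`. [cite: ShlapentokhRothman2014KleinGordon, Lemma 4.5] -/
theorem contDiffAt_yInf {p : ℂ × ℂ × ℂ} (hw : jostKconst γ₀ γ₁ * ‖jw m h γ₀ hR hR1 p‖ < 1) (r : ℝ) {n : WithTop ℕ∞} :
    ContDiffAt ℂ n (fun q ↦ yInf m h hR hR1 h₁ hγ q r) p :=
  contDiffAt_jostY_param h₁ hγ R₁ (contDiff_jw m h γ₀ hR hR1).contDiffAt hw r

/-- **Holomorphy of the derivative of the Jost family in the parameters** at fixed `r`. [cite: ShlapentokhRothman2014KleinGordon, Lemma 4.5] -/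
theorem contDiffAt_yInf' {p : ℂ × ℂ × ℂ} (hw : jostKconst γ₀ γ₁ * ‖jw m h γ₀ hR hR1 p‖ < 1) (r : ℝ) {n : WithTop ℕ∞} :
    ContDiffAt ℂ n (fun q ↦ yInf' m h hR hR1 h₁ hγ q r) p :=
  contDiffAt_jostYder_param h₁ hγ R₁ (contDiff_jw m h γ₀ hR hR1).contDiffAt hw r

end Family

end Literature.Barriers.FinalStateConjecture

end
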